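import Mathlib
import Literature.Barriers.ValiantsHypothesis.AlgebraicNaturalProofs
import Literature.Computability.AlgebraicComplexity.ArithCircuitProofs
import Summits.ValiantsHypothesis.ValiantsHypothesis.Theorems.BarrierLeverPartitionMinorsHitByVPTransvection

/-!
# Route BarrierLever — item `PartitionMinorsHitByVP` (stmt-ValiantsHypothesis-19717):
# transvection layouts composed with a cube automorphism

Helper file (`--supports stmt-ValiantsHypothesis-19717`; cell valiant-natproofs, rung V4, 𝒟-side,
prover seat val-np-p6 gen 2). Definition-free, outside the theses cone. Closes NO item.

`…StrataDoor.partitionMinor_hit_of_transvection` (p479486) hits `W = g_{a,b}(U)` for a transvection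
`g_{a,b}`. Composing with a cube automorphism on the column side, `W = σ(g_{a,b}(U) ∆ s)`, stays inside
the reach of TWO product states: the pairing of the states becomes `π = σ` (site `c` pairs `x_c` with
`y_{σ c}`) and the column bit of every site `c ∈ s` is flipped in the site tables. So the hit class
contains every image `U ↦ A(U)` for `A` in the set `(hyperoctahedral group) ∘ (one transvection)` of
affine maps of `𝔽₂^h`.

* `twoProdStatesC_mem_smallCircuits_perm` — two scaled general product states with an arbitrary
  common pairing `π` lie in `SmallCircuits ℂ (h+h) 3` (`h ≥ 4`) (the tree's
  `…ProductStatesC.twoProdStatesC_mem_smallCircuits` is the case `π = 1`).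
* **`partitionMinor_hit_of_transvection_automorphic`** (UNCONDITIONAL CLASS, `b = 3`, `h ≥ 4`).

WHAT THIS IS NOT: a thin structured class; nothing on general `GL_h(𝔽₂)` images, the middle band,
TT / 19616 / 19761, crux 14610 or VP vs VNP.
-/

set_option linter.dupNamespace false

namespace Summit.ValiantsHypothesis.ValiantsHypothesis.Theorems.BarrierLever.StrataDoor

open Finset MvPolynomial
open Literature.Barriers.ValiantsHypothesis Literature.Computability.AlgebraicComplexity
open Summit.ValiantsHypothesis.ValiantsHypothesis.Theorems.BarrierLever.ProductStatesC
  (coeff_prodStateC totalDegree_prodStateC_le complexity_prodStateC_le)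

variable {h r : ℕ}

/-- Two scaled general product states with a common pairing `π` lie in `SmallCircuits ℂ (h+h) 3`
(`h ≥ 4`). -/
theorem twoProdStatesC_mem_smallCircuits_perm (hh : 4 ≤ h) (π : Equiv.Perm (Fin h)) (k₁ k₂ : ℂ)
    (m₁ m₂ : Fin h → Bool → Bool → ℂ) :
    (C k₁ * (∏ a, ∑ p : Bool × Bool, C (m₁ a p.1 p.2) * X (Fin.castAdd h a) ^ p.1.toNat *
        X (Fin.natAdd h (π a)) ^ p.2.toNat) +
      C k₂ * (∏ a, ∑ p : Bool × Bool, C (m₂ a p.1 p.2) * X (Fin.castAdd h a) ^ p.1.toNat *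
        X (Fin.natAdd h (π a)) ^ p.2.toNat) : MvPolynomial (Fin (h + h)) ℂ) ∈
      SmallCircuits ℂ (h + h) 3 := by
  refine ⟨?_, ?_⟩
  · refine (totalDegree_add _ _).trans (max_le ?_ ?_) <;>
      refine (totalDegree_mul _ _).trans ?_ <;> rw [totalDegree_C, zero_add] <;>
      exact totalDegree_prodStateC_le _ _
  · calc _ ≤ complexity (C k₁ * (∏ a, ∑ p : Bool × Bool, C (m₁ a p.1 p.2) *
            X (Fin.castAdd h a) ^ p.1.toNat * X (Fin.natAdd h (π a)) ^ p.2.toNat) :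
            MvPolynomial (Fin (h + h)) ℂ) +
          complexity (C k₂ * (∏ a, ∑ p : Bool × Bool, C (m₂ a p.1 p.2) *
            X (Fin.castAdd h a) ^ p.1.toNat * X (Fin.natAdd h (π a)) ^ p.2.toNat) :
            MvPolynomial (Fin (h + h)) ℂ) + 1 := complexity_add_le_holds _ _
      _ ≤ (0 + 13 * h + 1) + (0 + 13 * h + 1) + 1 := by
          gcongr <;>
          · refine (complexity_mul_le_holds _ _).trans ?_
            gcongr
            · exact (complexity_C_holds _).le
            · exact complexity_prodStateC_le _ _
      _ ≤ (h + h) ^ 3 := by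
          have h8 : 8 ≤ h + h := by omega
          have h64 : 64 ≤ (h + h) * (h + h) := by nlinarith
          calc (0 + 13 * h + 1) + (0 + 13 * h + 1) + 1 = 13 * (h + h) + 3 := by ring
            _ ≤ (h + h) * (h + h) * (h + h) := by nlinarith
            _ = (h + h) ^ 3 := by ring

/-- **Transvection layouts composed with a cube automorphism are hit** (`b = 3`, `h ≥ 4`): if
`w (e i) = σ(g_{a,b}(u i) ∆ s)` for all `i` (`g_{a,b}(U) = U ∆ {b}` if `a ∈ U`, else `U`; `a ≠ b`;
`σ` a coordinate permutation, `s` a translation, `e` a permutation of `Fin r`), then a sum of two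
product states with pairing `σ` and the column bits of the sites in `s` flipped makes the layout matrix
of item 19717 nonsingular. -/
theorem partitionMinor_hit_of_transvection_automorphic (hh : 4 ≤ h) (a b : Fin h) (hab : a ≠ b)
    (σ : Equiv.Perm (Fin h)) (s : Finset (Fin h))
    (u w : Fin r → Finset (Fin h)) (hu : Function.Injective u) (e : Equiv.Perm (Fin r))
    (hw : ∀ i, w (e i) = (symmDiff (if a ∈ u i then symmDiff (u i) {b} else u i) s).image σ) :
    ∃ f ∈ SmallCircuits ℂ (h + h) 3,
      (Matrix.of fun i j : Fin r => MvPolynomial.coeff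
        (∑ a' ∈ u i, Finsupp.single (Fin.castAdd h a') 1 +
          ∑ c ∈ w j, Finsupp.single (Fin.natAdd h c) 1) f).det ≠ 0 := by
  classical
  -- site tables of `…partitionMinor_hit_of_transvection`, column bit flipped on `s`
  set m₁ : Fin h → Bool → Bool → ℂ := fun c p q =>
    if ((c = a → (p = false ∧ (if c ∈ s then !q else q) = false)) ∧
      (c ≠ a → p = (if c ∈ s then !q else q))) then 1 else 0 with hm₁
  set m₂ : Fin h → Bool → Bool → ℂ := fun c p q =>
    if ((c = a → (p = true ∧ (if c ∈ s then !q else q) = true)) ∧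
      (c = b → (p = true ↔ (if c ∈ s then !q else q) = false)) ∧
      ((c ≠ a ∧ c ≠ b) → p = (if c ∈ s then !q else q))) then 1 else 0 with hm₂
  set f : MvPolynomial (Fin (h + h)) ℂ :=
    C 1 * (∏ c, ∑ p : Bool × Bool, C (m₁ c p.1 p.2) * X (Fin.castAdd h c) ^ p.1.toNat *
        X (Fin.natAdd h (σ c)) ^ p.2.toNat) +
      C 1 * (∏ c, ∑ p : Bool × Bool, C (m₂ c p.1 p.2) * X (Fin.castAdd h c) ^ p.1.toNat *
        X (Fin.natAdd h (σ c)) ^ p.2.toNat) with hf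
  refine ⟨f, twoProdStatesC_mem_smallCircuits_perm hh σ 1 1 m₁ m₂, ?_⟩
  -- the flipped column bit recovers membership in `g(U')`
  have hflip : ∀ (V : Finset (Fin h)) (c : Fin h),
      (if c ∈ s then !decide (σ c ∈ (symmDiff V s).image σ) else decide (σ c ∈ (symmDiff V s).image σ))
        = decide (c ∈ V) := by
    intro V c
    have hmem : σ c ∈ (symmDiff V s).image σ ↔ c ∈ symmDiff V s := σ.injective.mem_finset_image
    by_cases hc : c ∈ s <;> by_cases hV : c ∈ V <;> simp [hmem, Finset.mem_symmDiff, hc, hV]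
  have hentry : ∀ i i' : Fin r, MvPolynomial.coeff
      (∑ a' ∈ u i, Finsupp.single (Fin.castAdd h a') 1 +
        ∑ c ∈ w (e i'), Finsupp.single (Fin.natAdd h c) 1) f = if i = i' then 1 else 0 := by
    intro i i'
    rw [hf, coeff_add, coeff_C_mul, coeff_C_mul, one_mul, one_mul, coeff_prodStateC, coeff_prodStateC,
      hw i']
    simp only [hm₁, hm₂]
    simp_rw [hflip]
    have key := transvection_entry a b hab (u i) (u i')
    rw [show (if i = i' then (1 : ℂ) else 0) = (if u i = u i' then 1 else 0) from by
      simp only [hu.eq_iff]]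
    exact key
  set M : Matrix (Fin r) (Fin r) ℂ := Matrix.of fun i j : Fin r => MvPolynomial.coeff
    (∑ a' ∈ u i, Finsupp.single (Fin.castAdd h a') 1 + ∑ c ∈ w j, Finsupp.single (Fin.natAdd h c) 1) f
    with hM
  have hsub : M.submatrix id e = 1 := by
    ext i j
    rw [Matrix.submatrix_apply, hM, Matrix.of_apply, id, hentry, Matrix.one_apply]
  have hdet : (M.submatrix id e).det = 1 := by rw [hsub, Matrix.det_one]
  rw [Matrix.det_permute'] at hdet
  intro h0
  rw [h0, mul_zero] at hdet
  exact zero_ne_one hdet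

end Summit.ValiantsHypothesis.ValiantsHypothesis.Theorems.BarrierLever.StrataDoor
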